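import Literature.Analysis.FluidPDE.BourgainPavlovicSchwartz
import Literature.Analysis.FluidPDE.NSFourierPathNorm
import Literature.Analysis.FluidPDE.NSFourierFamily
import HarnessLib

/-!
# The bump pieces of the Bourgain–Pavlović data and their pair interactions

Fourth support file for the discharge of the barrier
`Literature.Barriers.NavierStokesRegularity.CriticalBesovNormInflation` (Bourgain–Pavlović 2008,
Thm. 1.1). The Fourier-side datum `a₀` of `BourgainPavlovicData` is the sum of `4r` localised
pieces, one for each bump centre `c = ±k_s, ±k'_s` (`s < r`):
`a₀ = ∑_a i α ψ(· − c_a) polₐ`, with `polₐ = p` at the centres `±k_s` and `polₐ = q` at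
`±k'_s`. Accordingly the free evolution is `U(t) = ∑_a U_a(t)`,
`U_a(t, η) = i α e^{-c‖η‖²t} ψ(η − c_a) polₐ(η)` (`c = 4π²`), and the second Picard iterate
`u₁ = duhamelBilin c U U` (Bourgain–Pavlović's `u₁`, (3.5)) will be expanded (next file) into the
sum over ordered pairs of the pair interactions `duhamelBilin c U_a U_b` by bilinearity of the
tree's `nonlin`. This file provides the pieces and the generic tools for that expansion:

* generic additions to the Fourier-side toolkit (namespace `FourierNS`): additivity of `nonlin`
  in each slot and over finite sums of decaying fields (`nonlin_add_left/right`,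
  `nonlin_finset_sum_left/right`), a **support-restricted mass bound for Duhamel terms**
  (`massL1_duhamelBilin_le_of_support`: if the modulus convolution of the slices lives where
  `‖ξ‖ ≤ L` and `c‖ξ‖² ≥ κ`, then `massL1 (duhamelBilin c v w t) ≤ C L ∫₀ᵗ e^{-κ(t-r)} massL1(v r)
  massL1(w r) dr`), and the two exponential time integrals `∫₀ᵗ e^{-γr} ≤ 1/γ`,
  `∫₀ᵗ e^{-A(t-r)} e^{-Br} ≤ e^{-At}/(B-A)`;
* index bookkeeping for the bumps (`sgn`, `pol`, `center`, `idx`), the real pieces `pieceR` with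
  the sum formulas `piece_eq_sum_pieceR`, `datum_eq_sum`, the pieces of the free evolution
  `freePiece` with `free_eq_sum`, their support `‖η − c_a‖ < ρ` (so `N_s − 2 < ‖η‖ < N_s + 2`),
  joint continuity, decay of every order, the reflection symmetry `U_a(t,-η) = conj U_{ā}(t,η)`;
* the sizes: `‖U_a(t,η)‖ ≤ α ψ(η − c_a)(N_s + 2) e^{-2π²N_s²t}` (the heat factor on the support,
  `(N_s-2)² ≥ N_s²/2`) and the mass `massL1 (U_a t) ≤ α (N_s + 2) m e^{-2π²N_s²t}`, `m = ∫ψ`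
  (Bourgain–Pavlović's `‖e^{tΔ}u₀‖` bookkeeping of §3.2–3.3 in `L¹` form).

As recorded in the review of `BourgainPavlovicData`, the polarisations depart from
Bourgain–Pavlović's (3.3) (sine modes polarised along `e₀ = η` and `e₂`); the mechanism and
the bookkeeping of §3.2 are unchanged.

## References

* J. Bourgain, N. Pavlović, J. Funct. Anal. 255 (2008), §3.1–§3.2, (3.4)–(3.5) and the
  decomposition of `(e^{τΔ}u₀·∇)e^{τΔ}u₀` into `N₁ + N₂ + N₃`. [BourgainPavlovic2008]
-/

noncomputable section

open MeasureTheory Real Set Filter Topology Function Complex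
open scoped ComplexConjugate ENNReal NNReal

/-! ### Generic additions to the Fourier-side toolkit -/

namespace Literature.Analysis.FluidPDE.FourierNS

variable {ι : Type*} [Fintype ι] [DecidableEq ι]

/-- Additivity of `N` in the first slot (pointwise, for coefficient fields with integrable
decay). [folklore] -/
theorem nonlin_add_left {K₀ : ℕ} {v₁ v₂ w : EuclideanSpace ℝ ι → ι → ℂ}
    (hK₀ : Fintype.card ι < K₀) {A₁ A₂ B : ℝ}
    (h₁ : HasDecay K₀ A₁ v₁) (h₂ : HasDecay K₀ A₂ v₂) (hw : HasDecay K₀ B w)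
    (h₁m : AEStronglyMeasurable v₁ volume) (h₂m : AEStronglyMeasurable v₂ volume)
    (hwm : AEStronglyMeasurable w volume) (ξ : EuclideanSpace ℝ ι) :
    nonlin (v₁ + v₂) w ξ = nonlin v₁ w ξ + nonlin v₂ w ξ := by
  ext l
  simp only [nonlin_apply, Pi.add_apply]
  have hint : ∀ (u : EuclideanSpace ℝ ι → ι → ℂ) {Au : ℝ}, HasDecay K₀ Au u →
      AEStronglyMeasurable u volume → ∀ j k, Integrable fun η => u η j * w (ξ - η) k :=
    fun u Au hu hum j k =>
      (fconv_bound_mixed hK₀ (hu.apply j) (hu.apply j) (hw.apply k) (hw.apply k)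
        (aesm_apply hum j) (aesm_apply hwm k) ξ).1
  have hadd : ∀ j k, fconv (fun η => v₁ η j + v₂ η j) (w · k) ξ =
      fconv (v₁ · j) (w · k) ξ + fconv (v₂ · j) (w · k) ξ := fun j k =>
    fconv_add_left (f₁ := (v₁ · j)) (f₂ := (v₂ · j)) (hint v₁ h₁ h₁m j k) (hint v₂ h₂ h₂m j k)
  simp only [hadd, mul_add, Finset.sum_add_distrib]

/-- Additivity of `N` in the second slot. [folklore] -/
theorem nonlin_add_right {K₀ : ℕ} {v w₁ w₂ : EuclideanSpace ℝ ι → ι → ℂ}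
    (hK₀ : Fintype.card ι < K₀) {A B₁ B₂ : ℝ}
    (hv : HasDecay K₀ A v) (h₁ : HasDecay K₀ B₁ w₁) (h₂ : HasDecay K₀ B₂ w₂)
    (hvm : AEStronglyMeasurable v volume) (h₁m : AEStronglyMeasurable w₁ volume)
    (h₂m : AEStronglyMeasurable w₂ volume) (ξ : EuclideanSpace ℝ ι) :
    nonlin v (w₁ + w₂) ξ = nonlin v w₁ ξ + nonlin v w₂ ξ := by
  ext l
  simp only [nonlin_apply, Pi.add_apply]
  have hint : ∀ (u : EuclideanSpace ℝ ι → ι → ℂ) {Bu : ℝ}, HasDecay K₀ Bu u →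
      AEStronglyMeasurable u volume → ∀ j k, Integrable fun η => v η j * u (ξ - η) k :=
    fun u Bu hu hum j k =>
      (fconv_bound_mixed hK₀ (hv.apply j) (hv.apply j) (hu.apply k) (hu.apply k)
        (aesm_apply hvm j) (aesm_apply hum k) ξ).1
  have hadd : ∀ j k, fconv (v · j) (fun η => w₁ η k + w₂ η k) ξ =
      fconv (v · j) (w₁ · k) ξ + fconv (v · j) (w₂ · k) ξ := fun j k =>
    fconv_add_right (g₁ := (w₁ · k)) (g₂ := (w₂ · k)) (hint w₁ h₁ h₁m j k) (hint w₂ h₂ h₂m j k)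
  simp only [hadd, mul_add, Finset.sum_add_distrib]

/-- `N(0, w) = 0`. [folklore] -/
@[simp]
theorem nonlin_zero_left (w : EuclideanSpace ℝ ι → ι → ℂ) (ξ : EuclideanSpace ℝ ι) :
    nonlin 0 w ξ = 0 := by
  ext l
  simp [nonlin_apply, fconv_apply]

/-- `N(v, 0) = 0`. [folklore] -/
@[simp]
theorem nonlin_zero_right (v : EuclideanSpace ℝ ι → ι → ℂ) (ξ : EuclideanSpace ℝ ι) :
    nonlin v 0 ξ = 0 := by
  ext l
  simp [nonlin_apply, fconv_apply]

/-- **Additivity of `N` over finite sums in the first slot.** [folklore] -/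
theorem nonlin_finset_sum_left {α : Type*} (S : Finset α) {K₀ : ℕ} (hK₀ : Fintype.card ι < K₀)
    {A : α → ℝ} {B : ℝ} {v : α → EuclideanSpace ℝ ι → ι → ℂ} {w : EuclideanSpace ℝ ι → ι → ℂ}
    (hv : ∀ a ∈ S, HasDecay K₀ (A a) (v a))
    (hvm : ∀ a ∈ S, AEStronglyMeasurable (v a) volume) (hw : HasDecay K₀ B w)
    (hwm : AEStronglyMeasurable w volume) (ξ : EuclideanSpace ℝ ι) :
    nonlin (fun η => ∑ a ∈ S, v a η) w ξ = ∑ a ∈ S, nonlin (v a) w ξ := by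
  classical
  induction S using Finset.induction_on with
  | empty => simp [show (fun η : EuclideanSpace ℝ ι => (0 : ι → ℂ)) = 0 from rfl]
  | insert a S ha ih =>
    have h1 := hv a (Finset.mem_insert_self a S)
    have hS := hasDecay_finset_sum S (fun b hb => hv b (Finset.mem_insert_of_mem hb))
    have hSm : AEStronglyMeasurable (fun η => ∑ b ∈ S, v b η) volume := by
      have : (fun η => ∑ b ∈ S, v b η) = ∑ b ∈ S, v b := by funext η; simp
      rw [this]
      exact Finset.aestronglyMeasurable_sum S fun b hb => hvm b (Finset.mem_insert_of_mem hb)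
    have e : (fun η => ∑ b ∈ insert a S, v b η) = v a + fun η => ∑ b ∈ S, v b η := by
      funext η; simp [Finset.sum_insert ha]
    rw [e, nonlin_add_left hK₀ h1 hS hw (hvm a (Finset.mem_insert_self a S)) hSm hwm,
      Finset.sum_insert ha, ih (fun b hb => hv b (Finset.mem_insert_of_mem hb))
        (fun b hb => hvm b (Finset.mem_insert_of_mem hb))]

/-- **Additivity of `N` over finite sums in the second slot.** [folklore] -/
theorem nonlin_finset_sum_right {α : Type*} (S : Finset α) {K₀ : ℕ} (hK₀ : Fintype.card ι < K₀)
    {A : ℝ} {B : α → ℝ} {v : EuclideanSpace ℝ ι → ι → ℂ} {w : α → EuclideanSpace ℝ ι → ι → ℂ}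
    (hv : HasDecay K₀ A v) (hvm : AEStronglyMeasurable v volume)
    (hw : ∀ a ∈ S, HasDecay K₀ (B a) (w a))
    (hwm : ∀ a ∈ S, AEStronglyMeasurable (w a) volume) (ξ : EuclideanSpace ℝ ι) :
    nonlin v (fun η => ∑ a ∈ S, w a η) ξ = ∑ a ∈ S, nonlin v (w a) ξ := by
  classical
  induction S using Finset.induction_on with
  | empty => simp [show (fun η : EuclideanSpace ℝ ι => (0 : ι → ℂ)) = 0 from rfl]
  | insert a S ha ih =>
    have h1 := hw a (Finset.mem_insert_self a S)
    have hS := hasDecay_finset_sum S (fun b hb => hw b (Finset.mem_insert_of_mem hb))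
    have hSm : AEStronglyMeasurable (fun η => ∑ b ∈ S, w b η) volume := by
      have : (fun η => ∑ b ∈ S, w b η) = ∑ b ∈ S, w b := by funext η; simp
      rw [this]
      exact Finset.aestronglyMeasurable_sum S fun b hb => hwm b (Finset.mem_insert_of_mem hb)
    have e : (fun η => ∑ b ∈ insert a S, w b η) = w a + fun η => ∑ b ∈ S, w b η := by
      funext η; simp [Finset.sum_insert ha]
    rw [e, nonlin_add_right hK₀ hv h1 hS hvm (hwm a (Finset.mem_insert_self a S)) hSm,
      Finset.sum_insert ha, ih (fun b hb => hw b (Finset.mem_insert_of_mem hb))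
        (fun b hb => hwm b (Finset.mem_insert_of_mem hb))]

/-- **Support-restricted mass of a Duhamel term.** If the modulus convolution of the slices
vanishes off a set `S` on which `‖ξ‖ ≤ L` and the heat factor decays at rate `κ`
(`c‖ξ‖² ≥ κ`), then for `0 ≤ t`,
`massL1 (duhamelBilin c v w t) ≤ C L ∫₀ᵗ e^{-κ(t-r)} massL1(v r) massL1(w r) dr`. [folklore] -/
theorem massL1_duhamelBilin_le_of_support {c : ℝ}
    {v w : ℝ → EuclideanSpace ℝ ι → ι → ℂ} (hv : Continuous (uncurry v))
    (hw : Continuous (uncurry w)) {S : Set (EuclideanSpace ℝ ι)} {L κ : ℝ}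
    (hS : ∀ r ξ, ξ ∉ S → ∫⁻ η, ‖v r η‖ₑ * ‖w r (ξ - η)‖ₑ = 0)
    (hSL : ∀ ξ ∈ S, ‖ξ‖ ≤ L) (hSκ : ∀ ξ ∈ S, κ ≤ c * ‖ξ‖ ^ 2) {t : ℝ} (ht : 0 ≤ t) :
    massL1 (duhamelBilin c v w t) ≤ nonlinMassConst ι * ENNReal.ofReal L *
      ∫⁻ r in Ioc 0 t, ENNReal.ofReal (Real.exp (-κ * (t - r))) * (massL1 (v r) * massL1 (w r)) := by
  classical
  set H : ℝ → EuclideanSpace ℝ ι → ℝ≥0∞ := fun r ξ => ∫⁻ η, ‖v r η‖ₑ * ‖w r (ξ - η)‖ₑ with hH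
  have hHm : Measurable (uncurry fun (ξ : EuclideanSpace ℝ ι) (r : ℝ) => H r ξ) := by
    change Measurable ((fun p : ℝ × EuclideanSpace ℝ ι => H p.1 p.2) ∘ Prod.swap)
    exact (measurable_lintegral_enorm_mul_enorm_sub hv hw).comp measurable_swap
  -- pointwise in `ξ`: the heat factor and the weight `‖ξ‖` are bounded on `S`, and `H = 0` off `S`
  have hpt : ∀ ξ, ‖duhamelBilin c v w t ξ‖ₑ ≤ nonlinMassConst ι * ENNReal.ofReal L *
      ∫⁻ r in Ioc 0 t, ENNReal.ofReal (Real.exp (-κ * (t - r))) * H r ξ := by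
    intro ξ
    by_cases hξ : ξ ∈ S
    · calc ‖duhamelBilin c v w t ξ‖ₑ
          ≤ ∫⁻ r in Ioc 0 t, ENNReal.ofReal (heat c ξ (t - r)) * ‖nonlin (v r) (w r) ξ‖ₑ :=
            enorm_duhamelBilin_le c v w ht ξ
        _ ≤ ∫⁻ r in Ioc 0 t, ENNReal.ofReal (Real.exp (-κ * (t - r))) *
            (nonlinMassConst ι * ENNReal.ofReal L * H r ξ) := by
            refine setLIntegral_mono' measurableSet_Ioc fun r hr => mul_le_mul' ?_ ?_
            · refine ENNReal.ofReal_le_ofReal (Real.exp_le_exp.2 ?_)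
              have htr : 0 ≤ t - r := by linarith [hr.2]
              have := hSκ ξ hξ
              nlinarith
            · calc ‖nonlin (v r) (w r) ξ‖ₑ ≤ nonlinMassConst ι * ‖ξ‖ₑ * H r ξ :=
                    enorm_nonlin_le _ _ ξ
                _ ≤ nonlinMassConst ι * ENNReal.ofReal L * H r ξ := by
                    gcongr
                    rw [← ofReal_norm]
                    exact ENNReal.ofReal_le_ofReal (hSL ξ hξ)
        _ = nonlinMassConst ι * ENNReal.ofReal L *
            ∫⁻ r in Ioc 0 t, ENNReal.ofReal (Real.exp (-κ * (t - r))) * H r ξ := by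
            rw [← lintegral_const_mul' _ _ (ENNReal.mul_ne_top nonlinMassConst_lt_top.ne
              ENNReal.ofReal_ne_top)]
            refine lintegral_congr fun r => ?_
            ring
    · have h0 : ∀ r, nonlin (v r) (w r) ξ = 0 := fun r => by
        have h := enorm_nonlin_le (v r) (w r) ξ
        have hz : H r ξ = 0 := hS r ξ hξ
        simp only [hH] at hz
        rw [hz, mul_zero] at h
        simpa using h
      have : duhamelBilin c v w t ξ = 0 := by
        rw [duhamelBilin_apply]
        simp [h0]
      rw [this, enorm_zero]
      exact bot_le
  calc massL1 (duhamelBilin c v w t)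
      ≤ ∫⁻ ξ, nonlinMassConst ι * ENNReal.ofReal L *
          ∫⁻ r in Ioc 0 t, ENNReal.ofReal (Real.exp (-κ * (t - r))) * H r ξ := lintegral_mono hpt
    _ = nonlinMassConst ι * ENNReal.ofReal L *
          ∫⁻ r in Ioc 0 t, ENNReal.ofReal (Real.exp (-κ * (t - r))) * ∫⁻ ξ, H r ξ := by
        rw [lintegral_const_mul' _ _ (ENNReal.mul_ne_top nonlinMassConst_lt_top.ne
          ENNReal.ofReal_ne_top)]
        congr 1
        have hm2 : AEMeasurable (uncurry fun (ξ : EuclideanSpace ℝ ι) (r : ℝ) =>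
            ENNReal.ofReal (Real.exp (-κ * (t - r))) * H r ξ)
            (volume.prod (volume.restrict (Ioc 0 t))) := by
          have h1 : Measurable fun p : EuclideanSpace ℝ ι × ℝ =>
              ENNReal.ofReal (Real.exp (-κ * (t - p.2))) :=
            ENNReal.measurable_ofReal.comp (by fun_prop : Measurable fun p : EuclideanSpace ℝ ι × ℝ =>
              Real.exp (-κ * (t - p.2)))
          exact (h1.mul hHm).aemeasurable
        rw [lintegral_lintegral_swap hm2]
        refine lintegral_congr fun r => ?_
        rw [lintegral_const_mul' _ _ ENNReal.ofReal_ne_top]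
    _ = _ := by
        congr 1
        refine lintegral_congr fun r => ?_
        rw [lintegral_lintegral_enorm_mul_enorm_sub (hv.uncurry_left r) (hw.uncurry_left r)]


/-- `∫⁻_{(0,t]} e^{-γ r} dr ≤ 1/γ` for `γ > 0`. [folklore] -/
theorem lintegral_Ioc_exp_neg_le {γ : ℝ} (hγ : 0 < γ) (t : ℝ) :
    ∫⁻ r in Ioc 0 t, ENNReal.ofReal (Real.exp (-γ * r)) ≤ ENNReal.ofReal (1 / γ) := by
  rcases le_or_gt t 0 with ht | ht
  · rw [Ioc_eq_empty (not_lt.2 ht), Measure.restrict_empty, lintegral_zero_measure]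
    exact bot_le
  · have hcont : Continuous fun r => Real.exp (-γ * r) := by fun_prop
    rw [← ofReal_integral_eq_lintegral_ofReal hcont.integrableOn_Ioc
      (Eventually.of_forall fun r => (Real.exp_pos _).le), ← intervalIntegral.integral_of_le ht.le]
    refine ENNReal.ofReal_le_ofReal ?_
    have hderiv : ∀ r ∈ Set.uIcc (0 : ℝ) t,
        HasDerivAt (fun r => -Real.exp (-γ * r) / γ) (Real.exp (-γ * r)) r := by
      intro r _
      have h1 : HasDerivAt (fun r => -γ * r) (-γ) r := by
        simpa using (hasDerivAt_id r).const_mul (-γ)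
      have h2 := (h1.exp.neg).div_const γ
      have h3 : -(Real.exp (-γ * r) * -γ) / γ = Real.exp (-γ * r) := by
        field_simp
      rw [h3] at h2
      exact h2
    rw [intervalIntegral.integral_eq_sub_of_hasDerivAt hderiv (hcont.intervalIntegrable _ _)]
    simp only [mul_zero, Real.exp_zero]
    have : 0 ≤ Real.exp (-γ * t) / γ := by positivity
    have hγ' : 1 / γ = -(-1 / γ) := by ring
    rw [neg_div, neg_div, sub_neg_eq_add]
    linarith

/-- `∫⁻_{(0,t]} e^{-A(t-r)} e^{-B r} dr ≤ e^{-A t}/(B - A)` for `A < B`. [folklore] -/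
theorem lintegral_Ioc_exp_exp_le {A B : ℝ} (hAB : A < B) (t : ℝ) :
    ∫⁻ r in Ioc 0 t, ENNReal.ofReal (Real.exp (-A * (t - r))) * ENNReal.ofReal (Real.exp (-B * r)) ≤
      ENNReal.ofReal (Real.exp (-A * t) / (B - A)) := by
  have hγ : 0 < B - A := by linarith
  have heq : ∀ r, ENNReal.ofReal (Real.exp (-A * (t - r))) * ENNReal.ofReal (Real.exp (-B * r)) =
      ENNReal.ofReal (Real.exp (-A * t)) * ENNReal.ofReal (Real.exp (-(B - A) * r)) := fun r => by
    rw [← ENNReal.ofReal_mul (Real.exp_pos _).le, ← ENNReal.ofReal_mul (Real.exp_pos _).le,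
      ← Real.exp_add, ← Real.exp_add]
    congr 2; ring
  simp_rw [heq]
  rw [lintegral_const_mul' _ _ ENNReal.ofReal_ne_top, div_eq_mul_one_div,
    ENNReal.ofReal_mul (Real.exp_pos _).le]
  exact mul_le_mul' le_rfl (lintegral_Ioc_exp_neg_le hγ t)

end Literature.Analysis.FluidPDE.FourierNS

/-! ### The pieces of the Bourgain–Pavlović data -/

namespace Literature.Analysis.FluidPDE.BourgainPavlovic

open FourierNS Literature.Analysis.FunctionSpaces

/-- Local notation for frequency space `ℝ³`. -/
local notation "E3" => EuclideanSpace ℝ (Fin 3)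

/-- `4 < card (Fin 3) + 1`: the integrable order used throughout (`K₀ = 4`). [folklore] -/
theorem card_fin_three_lt_four : Fintype.card (Fin 3) < 4 := by simp

/-! #### Signs and polarisations (parameter-free) -/

/-- The sign attached to a bump index: `-1` for the reflected bumps. [folklore] -/
def sgn (neg : Bool) : ℝ := if neg then -1 else 1

/-- `sgn² = 1`. [folklore] -/
@[simp]
theorem sgn_mul_sgn (b : Bool) : sgn b * sgn b = 1 := by
  cases b <;> simp [sgn]

/-- `|sgn| = 1`. [folklore] -/
@[simp]
theorem abs_sgn (b : Bool) : |sgn b| = 1 := by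
  cases b <;> simp [sgn]

/-- The polarisation attached to a bump index: `p` for the `k`-bumps, `q` for the `k'`-bumps. [folklore] -/
def pol (prime : Bool) (ξ : E3) (j : Fin 3) : ℝ := if prime then polQ ξ j else polP ξ j

/-- `|pol(ξ)_j| ≤ ‖ξ‖`. [folklore] -/
theorem abs_pol_le (prime : Bool) (ξ : E3) (j : Fin 3) : |pol prime ξ j| ≤ ‖ξ‖ := by
  cases prime
  · exact abs_polP_le ξ j
  · exact abs_polQ_le ξ j

/-- The components of `pol` are continuous. [folklore] -/
theorem continuous_pol (prime : Bool) (j : Fin 3) : Continuous fun ξ : E3 => pol prime ξ j := by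
  cases prime
  · exact continuous_polP j
  · exact continuous_polQ j

/-- `ξ · pol(ξ) = 0`. [folklore] -/
theorem sum_mul_pol (prime : Bool) (ξ : E3) : ∑ j, ξ j * pol prime ξ j = 0 := by
  cases prime
  · exact sum_mul_polP ξ
  · exact sum_mul_polQ ξ

namespace InflationParams

variable (d : InflationParams)

/-! #### Index bookkeeping -/

/-- The centre of the bump with index `a = (s, neg, prime)`:
`c_a = ±(k_s − [prime] η)`, i.e. `k_s`, `−k_s`, `k'_s`, `−k'_s`. [cite: BourgainPavlovic2008, §3.1] -/
def center (a : ℕ × Bool × Bool) : E3 :=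
  sgn a.2.1 • (d.kvec a.1 - if a.2.2 then η else 0)

/-- The four centres of scale `s`. [folklore] -/
theorem center_cases (s : ℕ) :
    d.center (s, false, false) = d.kvec s ∧ d.center (s, true, false) = -d.kvec s ∧
      d.center (s, false, true) = d.kvec' s ∧ d.center (s, true, true) = -d.kvec' s := by
  simp [center, sgn, kvec']

/-- Components of a centre: `(c_a)_j = sgn_a (N_s [j = 1] − [prime] [j = 0])`. [folklore] -/
theorem center_apply (a : ℕ × Bool × Bool) (j : Fin 3) :
    d.center a j = sgn a.2.1 * ((if j = 1 then d.N a.1 else 0) -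
      if a.2.2 then (if j = 0 then 1 else 0) else 0) := by
  rcases a with ⟨s, neg, prime⟩
  cases prime <;> simp [center, kvec_apply, η_apply]

/-- `N_s − 1 ≤ ‖c_a‖`. [folklore] -/
theorem N_sub_one_le_norm_center (a : ℕ × Bool × Bool) : d.N a.1 - 1 ≤ ‖d.center a‖ := by
  rcases a with ⟨s, neg, prime⟩
  have h1 := d.N_sub_one_le_norm_kvec' s
  have h2 := d.norm_kvec s
  cases prime
  · simp only [center, Bool.false_eq_true, ↓reduceIte, sub_zero, norm_smul, Real.norm_eq_abs,
      abs_sgn, one_mul, h2]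
    linarith
  · simp only [center, ↓reduceIte, norm_smul, Real.norm_eq_abs, abs_sgn, one_mul]
    exact h1

/-- `‖c_a‖ ≤ N_s + 1`. [folklore] -/
theorem norm_center_le (a : ℕ × Bool × Bool) : ‖d.center a‖ ≤ d.N a.1 + 1 := by
  rcases a with ⟨s, neg, prime⟩
  have h1 := d.norm_kvec'_le s
  have h2 := d.norm_kvec s
  cases prime
  · simp only [center, Bool.false_eq_true, ↓reduceIte, sub_zero, norm_smul, Real.norm_eq_abs,
      abs_sgn, one_mul, h2]
    linarith
  · simp only [center, ↓reduceIte, norm_smul, Real.norm_eq_abs, abs_sgn, one_mul]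
    exact h1

/-- The index set of the `4r` bumps: `s < r`, a sign and a type. [folklore] -/
def idx : Finset (ℕ × Bool × Bool) := Finset.range d.r ×ˢ (Finset.univ ×ˢ Finset.univ)

/-- Membership in the index set. [folklore] -/
theorem mem_idx {a : ℕ × Bool × Bool} : a ∈ d.idx ↔ a.1 < d.r := by
  simp [idx]

/-! #### The real pieces and the sum formula for the datum -/

/-- **The real piece** attached to the bump `a`: `α ψ(η − c_a) polₐ(η)_j`. [cite: BourgainPavlovic2008, (3.1)] -/
def pieceR (a : ℕ × Bool × Bool) (η : E3) (j : Fin 3) : ℝ :=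
  d.α * (d.ψ (η - d.center a) * pol a.2.2 η j)

/-- The scale-`s` piece of the datum is the sum of its four bump pieces. [folklore] -/
theorem piece_eq_sum_pieceR (s : ℕ) (η : E3) (j : Fin 3) :
    d.piece s η j = ∑ b ∈ (Finset.univ ×ˢ Finset.univ : Finset (Bool × Bool)), d.pieceR (s, b) η j := by
  rw [Finset.sum_product, Fintype.sum_bool, Fintype.sum_bool, Fintype.sum_bool]
  simp only [pieceR, center, pol, sgn, piece, bumpK, bumpK', kvec']
  simp only [↓reduceIte, Bool.false_eq_true, neg_smul, one_smul, sub_neg_eq_add, sub_zero]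
  ring

/-- **The datum is the sum of its `4r` bump pieces** (times `i`). [cite: BourgainPavlovic2008, (3.1)] -/
theorem datum_eq_sum (η : E3) (j : Fin 3) :
    d.datum η j = Complex.I * ∑ a ∈ d.idx, (d.pieceR a η j : ℂ) := by
  rw [datum_apply, idx, Finset.sum_product]
  congr 1
  refine Finset.sum_congr rfl fun s _ => ?_
  rw [d.piece_eq_sum_pieceR s η j]
  push_cast
  rfl

/-- Support of a real piece: where it is nonzero, `‖η − c_a‖ < ρ`. [folklore] -/
theorem norm_sub_center_lt_of_pieceR_ne_zero {a : ℕ × Bool × Bool} {η : E3} {j : Fin 3}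
    (h : d.pieceR a η j ≠ 0) : ‖η - d.center a‖ < d.ρ := by
  apply d.norm_lt_of_ψ_ne_zero
  intro hψ
  exact h (by simp [pieceR, hψ])

/-- On the support of a piece the frequency has size `N_s − 2 < ‖η‖ < N_s + 2`. [folklore] -/
theorem norm_bounds_of_norm_sub_center_lt {a : ℕ × Bool × Bool} {η : E3}
    (h : ‖η - d.center a‖ < d.ρ) : d.N a.1 - 2 < ‖η‖ ∧ ‖η‖ < d.N a.1 + 2 := by
  have hρ := d.ρ_le
  have h1 := d.N_sub_one_le_norm_center a
  have h2 := d.norm_center_le a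
  have h3 : ‖d.center a‖ - ‖η‖ ≤ ‖η - d.center a‖ := by
    rw [norm_sub_rev]; exact norm_sub_norm_le _ _
  have h4 : ‖η‖ - ‖d.center a‖ ≤ ‖η - d.center a‖ := norm_sub_norm_le _ _
  constructor <;> linarith

/-- **Size of a real piece**: `|α ψ(η − c_a) polₐ(η)_j| ≤ α ψ(η − c_a) (N_s + 2)`. [folklore] -/
theorem abs_pieceR_le (a : ℕ × Bool × Bool) (η : E3) (j : Fin 3) :
    |d.pieceR a η j| ≤ d.α * d.ψ (η - d.center a) * (d.N a.1 + 2) := by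
  have hα := d.α_pos.le
  have hψ := d.ψ_nonneg (η - d.center a)
  by_cases hz : d.ψ (η - d.center a) = 0
  · simp [pieceR, hz]
  · have hη := (d.norm_bounds_of_norm_sub_center_lt (d.norm_lt_of_ψ_ne_zero hz)).2
    rw [pieceR, abs_mul, abs_mul, abs_of_nonneg hα, abs_of_nonneg hψ, mul_assoc]
    gcongr
    exact (abs_pol_le _ η j).trans hη.le

/-! #### The pieces of the free evolution -/

/-- **The piece of the free evolution** attached to the bump `a`:
`U_a(t, η)_j = i e^{-4π²‖η‖²t} α ψ(η − c_a) polₐ(η)_j`. [cite: BourgainPavlovic2008, (3.4)] -/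
def freePiece (a : ℕ × Bool × Bool) (t : ℝ) (η : E3) (j : Fin 3) : ℂ :=
  Complex.I * ((heat (4 * π ^ 2) η t * d.pieceR a η j : ℝ) : ℂ)

/-- **The free evolution is the sum of its pieces**: `U(t, η) = ∑_a U_a(t, η)`. [cite: BourgainPavlovic2008, (3.4)] -/
theorem free_eq_sum (t : ℝ) (η : E3) : d.free t η = ∑ a ∈ d.idx, d.freePiece a t η := by
  ext j
  rw [free_apply, Pi.smul_apply, Finset.sum_apply, datum_eq_sum]
  simp only [freePiece, Complex.ofReal_mul, Finset.mul_sum, Complex.real_smul]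
  refine Finset.sum_congr rfl fun a _ => ?_
  ring

/-- The free evolution as a function is the sum of the piece functions. [folklore] -/
theorem free_eq_sum_fun (t : ℝ) : d.free t = fun η => ∑ a ∈ d.idx, d.freePiece a t η :=
  funext (d.free_eq_sum t)

/-- Norm of a component of a piece. [folklore] -/
theorem norm_freePiece_apply (a : ℕ × Bool × Bool) (t : ℝ) (η : E3) (j : Fin 3) :
    ‖d.freePiece a t η j‖ = heat (4 * π ^ 2) η t * |d.pieceR a η j| := by
  rw [freePiece, norm_mul, Complex.norm_I, one_mul, Complex.norm_real, Real.norm_eq_abs, abs_mul,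
    abs_of_nonneg (heat_nonneg _ _ _)]

/-- Support of a piece of the free evolution: where it is nonzero, `‖η − c_a‖ < ρ`. [folklore] -/
theorem norm_sub_center_lt_of_freePiece_ne_zero {a : ℕ × Bool × Bool} {t : ℝ} {η : E3}
    (h : d.freePiece a t η ≠ 0) : ‖η - d.center a‖ < d.ρ := by
  obtain ⟨j, hj⟩ : ∃ j, d.freePiece a t η j ≠ 0 := by
    by_contra hc
    push Not at hc
    exact h (funext hc)
  have : d.pieceR a η j ≠ 0 := by
    intro hz
    apply hj
    simp [freePiece, hz]
  exact d.norm_sub_center_lt_of_pieceR_ne_zero this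

/-- `(N - 2)² ≥ N²/2` for the scales (`N ≥ 8`). [folklore] -/
theorem half_sq_le_sub_two_sq (s : ℕ) : d.N s ^ 2 / 2 ≤ (d.N s - 2) ^ 2 := by
  nlinarith [d.eight_le_N s]

/-- **The heat factor on the support of a piece**: for `t ≥ 0` and `‖η − c_a‖ < ρ`,
`e^{-4π²‖η‖²t} ≤ e^{-2π² N_s² t}`. [folklore] -/
theorem heat_le_of_norm_sub_center_lt {a : ℕ × Bool × Bool} {t : ℝ} (ht : 0 ≤ t) {η : E3}
    (h : ‖η - d.center a‖ < d.ρ) :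
    heat (4 * π ^ 2) η t ≤ Real.exp (-(2 * π ^ 2 * d.N a.1 ^ 2) * t) := by
  have hη := (d.norm_bounds_of_norm_sub_center_lt h).1
  have hN := d.eight_le_N a.1
  rw [heat]
  refine Real.exp_le_exp.2 ?_
  have h1 : (d.N a.1 - 2) ^ 2 ≤ ‖η‖ ^ 2 := by nlinarith [norm_nonneg η]
  have h2 := d.half_sq_le_sub_two_sq a.1
  have h4 : d.N a.1 ^ 2 - 2 * ‖η‖ ^ 2 ≤ 0 := by linarith
  have hπ : 0 ≤ π ^ 2 * t := by positivity
  have key : π ^ 2 * t * (d.N a.1 ^ 2 - 2 * ‖η‖ ^ 2) ≤ 0 := mul_nonpos_iff.2 (Or.inl ⟨hπ, h4⟩)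
  nlinarith [key]

/-- **Pointwise size of a piece of the free evolution**: for `t ≥ 0`,
`‖U_a(t, η)‖ ≤ α ψ(η − c_a) (N_s + 2) e^{-2π² N_s² t}` (sup norm on `ℂ³`). [folklore] -/
theorem norm_freePiece_le (a : ℕ × Bool × Bool) {t : ℝ} (ht : 0 ≤ t) (η : E3) :
    ‖d.freePiece a t η‖ ≤
      d.α * d.ψ (η - d.center a) * (d.N a.1 + 2) * Real.exp (-(2 * π ^ 2 * d.N a.1 ^ 2) * t) := by
  have hα := d.α_pos.le
  have hψ := d.ψ_nonneg (η - d.center a)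
  have hN := (d.N_pos a.1).le
  refine (pi_norm_le_iff_of_nonneg (by positivity)).2 fun j => ?_
  rw [norm_freePiece_apply]
  by_cases hz : d.ψ (η - d.center a) = 0
  · have : d.pieceR a η j = 0 := by simp [pieceR, hz]
    rw [this, abs_zero, mul_zero]
    positivity
  · have hsupp := d.norm_lt_of_ψ_ne_zero hz
    calc heat (4 * π ^ 2) η t * |d.pieceR a η j|
        ≤ Real.exp (-(2 * π ^ 2 * d.N a.1 ^ 2) * t) * (d.α * d.ψ (η - d.center a) * (d.N a.1 + 2)) :=
          mul_le_mul (d.heat_le_of_norm_sub_center_lt ht hsupp) (d.abs_pieceR_le a η j)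
            (abs_nonneg _) (Real.exp_pos _).le
      _ = _ := by ring

/-- Crude pointwise size: `‖U_a(t,η)‖ ≤ α (N_s + 2)` for `t ≥ 0`, and `0` off the ball of
radius `N_s + 2`. [folklore] -/
theorem norm_freePiece_le' (a : ℕ × Bool × Bool) {t : ℝ} (ht : 0 ≤ t) (η : E3) :
    ‖d.freePiece a t η‖ ≤ d.α * (d.N a.1 + 2) := by
  have hα := d.α_pos.le
  have hN := (d.N_pos a.1).le
  calc ‖d.freePiece a t η‖ ≤ d.α * d.ψ (η - d.center a) * (d.N a.1 + 2) *
        Real.exp (-(2 * π ^ 2 * d.N a.1 ^ 2) * t) := d.norm_freePiece_le a ht η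
    _ ≤ d.α * 1 * (d.N a.1 + 2) * 1 := by
        gcongr
        · exact d.ψ_le_one _
        · rw [Real.exp_le_one_iff]
          have : 0 ≤ 2 * π ^ 2 * d.N a.1 ^ 2 * t := by positivity
          linarith
    _ = d.α * (d.N a.1 + 2) := by ring

/-- The pieces vanish outside the ball of radius `N_s + 2`. [folklore] -/
theorem freePiece_eq_zero_of_le {a : ℕ × Bool × Bool} (t : ℝ) {η : E3} (h : d.N a.1 + 2 ≤ ‖η‖) :
    d.freePiece a t η = 0 := by
  by_contra hne
  have := (d.norm_bounds_of_norm_sub_center_lt (d.norm_sub_center_lt_of_freePiece_ne_zero hne)).2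
  linarith

/-- **Decay of every order of the pieces**, uniformly in `t ≥ 0`. [folklore] -/
theorem hasDecay_freePiece (a : ℕ × Bool × Bool) {t : ℝ} (ht : 0 ≤ t) (K : ℕ) :
    HasDecay K (d.α * (d.N a.1 + 2) * (d.N a.1 + 3) ^ K) (d.freePiece a t) := by
  intro η
  have hα := d.α_pos.le
  have hN := (d.N_pos a.1).le
  by_cases h : d.N a.1 + 2 ≤ ‖η‖
  · rw [d.freePiece_eq_zero_of_le t h, norm_zero]; positivity
  · push Not at h
    have hw : (1 : ℝ) ≤ (d.N a.1 + 3) ^ K * ((1 + ‖η‖) ^ K)⁻¹ := by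
      rw [le_mul_inv_iff₀ (by positivity), one_mul]
      exact pow_le_pow_left₀ (by positivity) (by linarith) K
    calc ‖d.freePiece a t η‖ ≤ d.α * (d.N a.1 + 2) := d.norm_freePiece_le' a ht η
      _ ≤ d.α * (d.N a.1 + 2) * ((d.N a.1 + 3) ^ K * ((1 + ‖η‖) ^ K)⁻¹) :=
          le_mul_of_one_le_right (by positivity) hw
      _ = _ := by ring

/-- The pieces are jointly continuous in `(t, η)`. [folklore] -/
theorem continuous_freePiece (a : ℕ × Bool × Bool) : Continuous (uncurry (d.freePiece a)) := by
  apply continuous_pi fun j => ?_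
  change Continuous fun p : ℝ × E3 => d.freePiece a p.1 p.2 j
  simp only [freePiece, pieceR]
  refine continuous_const.mul (Complex.continuous_ofReal.comp ?_)
  refine (continuous_heat_comp _ continuous_snd continuous_fst).mul
    (continuous_const.mul ((d.continuous_ψ.comp (continuous_snd.sub continuous_const)).mul
      ((continuous_pol a.2.2 j).comp continuous_snd)))

/-- The slices of the pieces are continuous. [folklore] -/
theorem continuous_freePiece_slice (a : ℕ × Bool × Bool) (t : ℝ) : Continuous (d.freePiece a t) :=
  (d.continuous_freePiece a).uncurry_left t

/-- The conjugation symmetry of the pieces pairs `a` with its reflection: `U_a(t,-η) = conj U_{ā}(t,η)`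
where `ā` has the opposite sign (the real pieces are odd under `(a, η) ↦ (ā, -η)`). [folklore] -/
theorem freePiece_neg (s : ℕ) (neg prime : Bool) (t : ℝ) (η : E3) (j : Fin 3) :
    d.freePiece (s, neg, prime) t (-η) j = conj (d.freePiece (s, !neg, prime) t η j) := by
  have hc : d.center (s, neg, prime) = -d.center (s, !neg, prime) := by
    cases neg <;> simp [center, sgn]
  have hpol : pol prime (-η) j = -pol prime η j := by
    cases prime
    · exact polP_neg η j
    · exact polQ_neg η j
  simp only [freePiece, pieceR, map_mul, Complex.conj_I, Complex.conj_ofReal, heat_neg, hpol, hc,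
    show -η - -d.center (s, !neg, prime) = -(η - d.center (s, !neg, prime)) by abel, d.ψ_neg]
  push_cast
  ring

/-! #### Masses of the pieces -/

/-- `ψ(· − c)` has integral `m`. [folklore] -/
theorem integral_ψ_sub (c₀ : E3) : ∫ η, d.ψ (η - c₀) = d.bumpMass := by
  rw [integral_sub_right_eq_self d.ψ c₀, bumpMass]

/-- **Mass of a piece of the free evolution**: for `t ≥ 0`,
`massL1 (U_a t) ≤ α (N_s + 2) m e^{-2π² N_s² t}`. [folklore] -/
theorem massL1_freePiece_le (a : ℕ × Bool × Bool) {t : ℝ} (ht : 0 ≤ t) :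
    massL1 (d.freePiece a t) ≤ ENNReal.ofReal
      (d.α * (d.N a.1 + 2) * d.bumpMass * Real.exp (-(2 * π ^ 2 * d.N a.1 ^ 2) * t)) := by
  have hα := d.α_pos.le
  have hN := (d.N_pos a.1).le
  set C : ℝ := d.α * (d.N a.1 + 2) * Real.exp (-(2 * π ^ 2 * d.N a.1 ^ 2) * t) with hC
  have hC0 : 0 ≤ C := by positivity
  calc massL1 (d.freePiece a t) ≤ ∫⁻ η, ENNReal.ofReal (C * d.ψ (η - d.center a)) := by
        refine lintegral_mono fun η => ?_
        rw [← ofReal_norm]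
        refine ENNReal.ofReal_le_ofReal ?_
        calc ‖d.freePiece a t η‖ ≤ _ := d.norm_freePiece_le a ht η
          _ = C * d.ψ (η - d.center a) := by rw [hC]; ring
    _ = ENNReal.ofReal (∫ η, C * d.ψ (η - d.center a)) := by
        rw [ofReal_integral_eq_lintegral_ofReal ((d.integrable_ψ.comp_sub_right _).const_mul C)
          (Eventually.of_forall fun η => mul_nonneg hC0 (d.ψ_nonneg _))]
    _ = _ := by
        rw [integral_const_mul, integral_ψ_sub, hC]
        congr 1; ring

end InflationParams

end Literature.Analysis.FluidPDE.BourgainPavlovic
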